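import Summits.QuantumAdvantage.QuantumAdvantage.Theorems.SosSandwichTransferPBLogScaleFinal
import Summits.QuantumAdvantage.QuantumAdvantage.Theorems.SosSandwichTransferPBBoundedQueries
import Summits.QuantumAdvantage.QuantumAdvantage.Theorems.SosSandwichQueryAAQCalibration
import Summits.QuantumAdvantage.QuantumAdvantage.Theses.RandomOracleGauge
import HarnessLib

/-!
# `BQP^{A[log]} ⊆ AvgP^A` almost surely from `PromiseBQP ⊆ PromiseBPP'` — RandomOracleGauge's `LogQueryTransfer` (stmt-1155), NO conjecture

Route `SosSandwich` × `RandomOracleGauge` (shared hypothesis-type crux `RandomOracleHeurSeparation`, stmt-QuantumAdvantage-1131).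
Aaronson–Ambainis' Thm. 26 says: for `BQP^A` machines making `O(log n)` oracle queries, the Dinur–Friedgut–Kindler–O'Donnell
bound (`Inf ≥ ε⁵/2^{O(d)}`) replaces their conjecture, since `2^{O(d)} = poly(n)`.  Route RandomOracleGauge filed this, in the
tree's promise-transfer form (`P = P^{#P}` replaced by `PromiseBQP ⊆ PromiseBPP'`), as the support item `LogQueryTransfer`
(stmt-QuantumAdvantage-1155).  This file PROVES IT BY NAME:

* `two_pow_degree_le_of_logQueries`, `scaleBound_of_logQueries` — with `≤ c'·log₂ n + c'` oracle gates the machine-scale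
  influence hypothesis of `…TransferPBLogScale*.lean` holds UNCONDITIONALLY (DFKO via the circuit→query bridge,
  `QueryPathBridge.pathBound_expLoss`; error polynomial bumped to `r + X`, constants `c = a + 4Cc'`, `k = 2C(2c'+1)`);
* `oracleSimulationSc_of_logQueries` — the promise-oracle simulation of every such uniform family, machine level;
* **`logQueryTransfer : RandomOracleGauge.LogQueryTransfer`** — through the class-restricted glue
  (`TransferPBGlue.ae_subset_AvgPRel_of_simulationOn`, one class per constant `c'`, countable intersection over `c'`).

Honest label: the hypothesis `PromiseBQP ⊆ PromiseBPP'` is believed false — this is a TRANSFER theorem (what a promise collapse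
would dequantize relative to random oracles), now with no influence conjecture for `O(log n)` queries; the full `BQP^A` transfer
still needs `AA_Q`.  Sources: AaronsonAmbainis2014 Thm. 26, Thm. 23; DinurEtAl2007 Thm. 3; BennettGill1981.
-/

-- D-0017: single-conjunct summit ⇒ the duplicate `QuantumAdvantage.QuantumAdvantage` is mandated.
set_option linter.dupNamespace false

noncomputable section

namespace Summit.QuantumAdvantage.QuantumAdvantage.Cruxes.TransferPB.Birth

open Finset MeasureTheory Literature.Computability.Cryptography Literature.Computability.Complexity
  Literature.Computability.QuantumComplexity Literature.Computability.QuantumComplexity.ClassicalSimulation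
open Summit.QuantumAdvantage.QuantumAdvantage.Theses.SosSandwich
open scoped ENNReal

namespace SimTreePB

/-! ### Log-query families meet the machine-scale bound UNCONDITIONALLY (DFKO through the bridge) -/

/-- Arithmetic of the log-query regime: `2^{C·2d} ≤ 2^{2C(2c'+1)} · (n+1)^{4Cc'}` when `d = 2q+1`, `q ≤ c' log₂ n + c'`.
[folklore] -/
theorem two_pow_degree_le_of_logQueries {C c' q n : ℕ} (hq : q ≤ c' * Nat.log 2 n + c') (hn : 1 ≤ n) :
    2 ^ (C * (2 * (2 * q + 1))) ≤ 2 ^ (2 * C * (2 * c' + 1)) * (n + 1) ^ (4 * C * c') := by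
  have hd : C * (2 * (2 * q + 1)) ≤ 2 * C * (2 * c' + 1) + Nat.log 2 n * (4 * C * c') := by
    have h1 : C * (2 * (2 * q + 1)) ≤ C * (2 * (2 * (c' * Nat.log 2 n + c') + 1)) :=
      Nat.mul_le_mul_left _ (by omega)
    have e : C * (2 * (2 * (c' * Nat.log 2 n + c') + 1)) = 2 * C * (2 * c' + 1) + Nat.log 2 n * (4 * C * c') := by
      ring
    omega
  calc 2 ^ (C * (2 * (2 * q + 1))) ≤ 2 ^ (2 * C * (2 * c' + 1) + Nat.log 2 n * (4 * C * c')) :=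
        Nat.pow_le_pow_right (by norm_num) hd
    _ = 2 ^ (2 * C * (2 * c' + 1)) * (2 ^ Nat.log 2 n) ^ (4 * C * c') := by
        rw [pow_add, pow_mul 2 (Nat.log 2 n) (4 * C * c')]
    _ ≤ 2 ^ (2 * C * (2 * c' + 1)) * (n + 1) ^ (4 * C * c') := by
        apply Nat.mul_le_mul_left
        apply Nat.pow_le_pow_left
        exact (Nat.pow_log_le_self 2 (by omega)).trans (Nat.le_succ n)

/-- **Uniform families with `O(log n)` oracle gates satisfy the machine-scale influence bound UNCONDITIONALLY.**  With the
error polynomial bumped to `r' = r + X` (so that the machine's variance scale is `≤ 1/(400(n+1))`) and constants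
`c = a + 4Cc'`, `k = 2C(2c'+1)` (`a, C` the DFKO constants of `QueryPathBridge.pathBound_expLoss`): at scale
`ε = θ'/2 ≤ 1/(n+1)` the polynomial slack `ε^{4Cc'} ≤ (n+1)^{-4Cc'}` absorbs the exponential loss `2^{C·2·thm23Degree} ≤
2^{2C(2c'+1)} (n+1)^{4Cc'}` of the proved bound. [cite: DinurEtAl2007, Thm. 3] [cite: AaronsonAmbainis2014, Thm. 26 (proof)] -/
theorem scaleBound_of_logQueries (c' : ℕ) (F₀ : QCircuitFamily cliffordT)
    (hlog : ∀ n, (F₀.circ n).oracleQueries ≤ c' * Nat.log 2 n + c') :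
    ∀ r : Polynomial ℕ, ∃ (r' : Polynomial ℕ) (c k : ℕ), (∀ n, r.eval n ≤ r'.eval n) ∧
      ∀ (x : List Bool), 1 ≤ x.length → ∀ ρ : List (Fin (numOracleBits F₀ x) × Bool),
        ((1 / 10 : ℝ) ^ 2 * (1 / (((r'.eval x.length : ℕ) : ℝ) + 1)) / 2) / 2 <
            boolVariance (restrictPath ρ (acceptPoly F₀ x)) →
          ∃ i : Fin (numOracleBits F₀ x),
            (1 / 2 ^ k : ℝ) * ((((1 / 10 : ℝ) ^ 2 * (1 / (((r'.eval x.length : ℕ) : ℝ) + 1)) / 2) / 2) /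
              thm23Degree F₀ x) ^ c ≤ influence i (restrictPath ρ (acceptPoly F₀ x)) := by
  obtain ⟨a, C, H⟩ :=
    Summit.QuantumAdvantage.QuantumAdvantage.Theorems.SosSandwich.QueryPathBridge.pathBound_expLoss cliffordT_isUnitary_holds
  intro r
  refine ⟨r + Polynomial.X, a + 4 * C * c', 2 * C * (2 * c' + 1), fun n => by simp, fun x hx ρ hv => ?_⟩
  set ε : ℝ := ((1 / 10 : ℝ) ^ 2 * (1 / ((((r + Polynomial.X).eval x.length : ℕ) : ℝ) + 1)) / 2) / 2 with hε
  have hεpos : 0 < ε := by positivity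
  obtain ⟨i, hi⟩ := H F₀ x ρ ε hεpos hv.le
  refine ⟨i, le_trans ?_ hi⟩
  -- the scale is below `1/(n+1)`
  have hr' : (((r + Polynomial.X).eval x.length : ℕ) : ℝ) = ((r.eval x.length : ℕ) : ℝ) + (x.length : ℝ) := by
    rw [Polynomial.eval_add, Polynomial.eval_X, Nat.cast_add]
  have hε1 : ε ≤ 1 / ((x.length : ℝ) + 1) := by
    rw [hε, hr']
    have h0 : (0 : ℝ) ≤ 1 / (((r.eval x.length : ℕ) : ℝ) + (x.length : ℝ) + 1) := by positivity
    have hA : (1 / 10 : ℝ) ^ 2 * (1 / (((r.eval x.length : ℕ) : ℝ) + (x.length : ℝ) + 1)) / 2 / 2 =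
        (1 / (((r.eval x.length : ℕ) : ℝ) + (x.length : ℝ) + 1)) / 400 := by ring
    rw [hA]
    refine (div_le_self h0 (by norm_num)).trans ?_
    exact one_div_le_one_div_of_le (by positivity) (by linarith [(Nat.cast_nonneg (r.eval x.length) : (0 : ℝ) ≤ _)])
  have hd1 : (1 : ℝ) ≤ thm23Degree F₀ x := by
    exact_mod_cast (show 1 ≤ thm23Degree F₀ x by unfold thm23Degree; omega)
  -- the Nat arithmetic of the regime, cast to `ℝ`
  have hNat := two_pow_degree_le_of_logQueries (C := C) (hlog x.length) hx
  have hdeg : thm23Degree F₀ x = 2 * (F₀.circ x.length).oracleQueries + 1 := rfl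
  have hR : (2 : ℝ) ^ (C * (2 * thm23Degree F₀ x)) ≤
      (2 : ℝ) ^ (2 * C * (2 * c' + 1)) * ((x.length : ℝ) + 1) ^ (4 * C * c') := by
    rw [hdeg]; exact_mod_cast hNat
  have h2pos : (0 : ℝ) < (2 : ℝ) ^ (C * (2 * thm23Degree F₀ x)) := by positivity
  have hB : (1 / 2 ^ (2 * C * (2 * c' + 1)) : ℝ) * (1 / ((x.length : ℝ) + 1)) ^ (4 * C * c') ≤
      1 / (2 : ℝ) ^ (C * (2 * thm23Degree F₀ x)) := by
    rw [div_pow, one_pow, one_div_mul_one_div]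
    exact one_div_le_one_div_of_le h2pos hR
  -- assemble
  have hstep1 : (ε / thm23Degree F₀ x) ^ (a + 4 * C * c') ≤ ε ^ (a + 4 * C * c') :=
    pow_le_pow_left₀ (div_nonneg hεpos.le (by positivity)) (div_le_self hεpos.le hd1) _
  have hstep2 : ε ^ (4 * C * c') ≤ (1 / ((x.length : ℝ) + 1)) ^ (4 * C * c') :=
    pow_le_pow_left₀ hεpos.le hε1 _
  calc (1 / 2 ^ (2 * C * (2 * c' + 1)) : ℝ) * (ε / thm23Degree F₀ x) ^ (a + 4 * C * c')
      ≤ (1 / 2 ^ (2 * C * (2 * c' + 1)) : ℝ) * (ε ^ a * (1 / ((x.length : ℝ) + 1)) ^ (4 * C * c')) := by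
        apply mul_le_mul_of_nonneg_left _ (by positivity)
        calc (ε / thm23Degree F₀ x) ^ (a + 4 * C * c') ≤ ε ^ (a + 4 * C * c') := hstep1
          _ = ε ^ a * ε ^ (4 * C * c') := pow_add _ _ _
          _ ≤ ε ^ a * (1 / ((x.length : ℝ) + 1)) ^ (4 * C * c') :=
              mul_le_mul_of_nonneg_left hstep2 (by positivity)
    _ = ε ^ a * ((1 / 2 ^ (2 * C * (2 * c' + 1)) : ℝ) * (1 / ((x.length : ℝ) + 1)) ^ (4 * C * c')) := by ring
    _ ≤ ε ^ a * (1 / (2 : ℝ) ^ (C * (2 * thm23Degree F₀ x))) := mul_le_mul_of_nonneg_left hB (by positivity)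
    _ = ε ^ a / (2 : ℝ) ^ (C * (2 * thm23Degree F₀ x)) := by ring

/-- **UNCONDITIONAL promise-oracle simulation for uniform families with `O(log n)` oracle gates** (Aaronson–Ambainis'
`BQP^{A[log]}`, Thm. 26, machine level, no conjecture). [cite: AaronsonAmbainis2014, Thm. 26] [cite: DinurEtAl2007, Thm. 3] -/
theorem oracleSimulationSc_of_logQueries (c' : ℕ) (F₀ : QCircuitFamily cliffordT)
    (hlog : ∀ n, (F₀.circ n).oracleQueries ≤ c' * Nat.log 2 n + c') :
    F₀.IsUniform → ∀ r : Polynomial ℕ,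
        ∃ Q ∈ Literature.Computability.Cryptography.PromiseBQP, ∃ (C : OracleAlg Bool) (q : Polynomial ℕ),
          C.IsPolyTime Computability.encodingBoolBool ∧
          (∀ (O : Oracle) (x : List Bool), ∀ y ∈ C.queries O (q.eval x.length) x, y.length ≤ q.eval x.length) ∧
          ∀ x : List Bool, 1 ≤ x.length → ∀ g : List Bool → Bool,
            (∀ v ∈ Q.yes, g v = true) → (∀ v ∈ Q.no, g v = false) →
            (ProbabilityTheory.setBernoulli (Set.univ : Set (List Bool)) ⟨1 / 2, by norm_num, by norm_num⟩)
              {A : Set (List Bool) |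
                (2 / 3 ≤ F₀.acceptProbOn A x ∧
                  C.run (Oracle.ofLanguage {w : List Bool | ∃ v : List Bool, (w = false :: v ∧ v ∈ A) ∨
                    (w = true :: v ∧ g v = true)}) (q.eval x.length) x ≠ some true) ∨
                (F₀.acceptProbOn A x ≤ 1 / 3 ∧
                  C.run (Oracle.ofLanguage {w : List Bool | ∃ v : List Bool, (w = false :: v ∧ v ∈ A) ∨
                    (w = true :: v ∧ g v = true)}) (q.eval x.length) x ≠ some false)}
              ≤ ENNReal.ofReal (1 / (((r.eval x.length : ℕ) : ℝ) + 1)) :=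
  oracleSimulationSc_of_scaleBound F₀ (scaleBound_of_logQueries c' F₀ hlog)

end SimTreePB

end Summit.QuantumAdvantage.QuantumAdvantage.Cruxes.TransferPB.Birth

namespace Summit.QuantumAdvantage.QuantumAdvantage.Theorems.SosSandwich.TransferPBGlue

open MeasureTheory Filter Literature.Computability.Complexity Literature.Computability.Cryptography
  Literature.Computability.QuantumComplexity
open Summit.QuantumAdvantage.QuantumAdvantage.Cruxes.TransferPB.Birth

/-- **`BQP^{A[c' log]} ⊆ AvgP^A` almost surely, for each constant `c'`, given `PromiseBQP ⊆ PromiseBPP'`** (class-restricted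
glue over `SimTreePB.oracleSimulationSc_of_logQueries`). [cite: AaronsonAmbainis2014, Thm. 26] -/
theorem ae_logQuery_subset_AvgPRel (c' : ℕ)
    (hPr : Literature.Computability.Cryptography.PromiseBQP ⊆ Literature.Computability.Complexity.PromiseBPP') :
    ∀ᵐ A ∂randomOracle,
      {L : Language Bool | ∃ F : QCircuitFamily cliffordT, F.IsUniform ∧
          (∀ n, ((F.circ n).gates.filter (fun g => ¬ g.IsOracleFree)).length ≤ c' * Nat.log 2 n + c') ∧
          ∀ x, (x ∈ L → 2 / 3 ≤ F.acceptProbOn (A : Language Bool) x) ∧ (x ∉ L → F.acceptProbOn A x ≤ 1 / 3)} ⊆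
        Literature.Computability.Complexity.AvgPRel (Oracle.ofLanguage (A : Language Bool)) :=
  ae_subset_AvgPRel_of_simulationOn
    (fun F => ∀ n, ((F.circ n).gates.filter (fun g => ¬ g.IsOracleFree)).length ≤ c' * Nat.log 2 n + c')
    (fun F₀ hP => SimTreePB.oracleSimulationSc_of_logQueries c' F₀ hP) stub_promiseOracleElimination hPr

/-- **RandomOracleGauge's support item `LogQueryTransfer` (stmt-QuantumAdvantage-1155) holds — BY NAME, unconditionally**:
`PromiseBQP ⊆ PromiseBPP' → ∀ᵐ A, ∀ c F, F uniform with ≤ c·log₂ n + c oracle gates → every language F^A decides with bounded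
error lies in AvgP^A` (Aaronson–Ambainis Thm. 26 in promise-transfer form; `randomOracleMeasure = randomOracle`,
`Barriers….AvgPRel = Complexity.AvgPRel` definitionally; countable intersection over `c`). [cite: AaronsonAmbainis2014, Thm. 26] -/
theorem logQueryTransfer : Summit.QuantumAdvantage.QuantumAdvantage.Theses.RandomOracleGauge.LogQueryTransfer := by
  intro hPr
  have h : ∀ᵐ A ∂randomOracle, ∀ c' : ℕ,
      {L : Language Bool | ∃ F : QCircuitFamily cliffordT, F.IsUniform ∧
          (∀ n, ((F.circ n).gates.filter (fun g => ¬ g.IsOracleFree)).length ≤ c' * Nat.log 2 n + c') ∧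
          ∀ x, (x ∈ L → 2 / 3 ≤ F.acceptProbOn (A : Language Bool) x) ∧ (x ∉ L → F.acceptProbOn A x ≤ 1 / 3)} ⊆
        Literature.Computability.Complexity.AvgPRel (Oracle.ofLanguage (A : Language Bool)) := by
    rw [ae_all_iff]
    exact fun c' => ae_logQuery_subset_AvgPRel c' hPr
  rw [Literature.Computability.QuantumComplexity.randomOracleMeasure_eq_randomOracle]
  filter_upwards [h] with A hA
  intro c F hF hlog L hL
  exact hA c ⟨F, hF, hlog, hL⟩

end Summit.QuantumAdvantage.QuantumAdvantage.Theorems.SosSandwich.TransferPBGlue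

end
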